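import Mathlib.MeasureTheory.Measure.Haar.InnerProductSpace
import Mathlib.MeasureTheory.Measure.Lebesgue.Complex
import Mathlib.Analysis.InnerProductSpace.PiL2
import Mathlib.LinearAlgebra.Complex.FiniteDimensional
import HarnessLib

/-!
# Lebesgue measure on `ℂ^ι`: functions versus Euclidean space

`Literature/MeasureTheory/Lebesgue/`. Mathlib identifies the volume of `EuclideanSpace ℝ ι`
(the Lebesgue measure of a finite-dimensional real inner product space, normalised on orthonormal
parallelepipeds) with the product Lebesgue measure of `ι → ℝ` (`PiLp.volume_preserving_toLp`),
but has no complex counterpart. This file supplies it: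

* `volume_preserving_toLp_complex` — `toLp 2 : (ι → ℂ) → EuclideanSpace ℂ ι` is measure
  preserving for the two `volume`s (product of the planar Lebesgue measures of the coordinates,
  resp. the inner-product-space volume for the real structure `Re ⟪·, ·⟫`),

by evaluating the product measure on the parallelepiped of the real orthonormal basis
`{eᵢ, i eᵢ}` (`realBasis`), a product of unit squares. All [folklore].
-/

noncomputable section

open MeasureTheory Module Complex Set WithLp
open scoped ENNReal

namespace Literature.MeasureTheory.Lebesgue

variable (ι : Type*) [Fintype ι] [DecidableEq ι]

/-- The real orthonormal frame `(i, 0) ↦ eᵢ`, `(i, 1) ↦ i·eᵢ` of `ℂ^ι`. [folklore] -/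
def realFrame : ι × Fin 2 → EuclideanSpace ℂ ι :=
  fun x => EuclideanSpace.single x.1 (if x.2 = 0 then (1 : ℂ) else I)

omit [DecidableEq ι] in
/-- The real inner product of `ℂ^ι` is the real part of the complex one. [folklore] -/
theorem real_inner_eq_re_inner_euclideanSpace (x y : EuclideanSpace ℂ ι) :
    (inner ℝ x y : ℝ) = (inner ℂ x y).re := by
  rw [PiLp.inner_apply, PiLp.inner_apply, Complex.re_sum]
  refine Finset.sum_congr rfl fun i _ => ?_
  rw [real_inner_eq_re_inner ℂ]
  rfl

/-- The real frame is orthonormal for `Re ⟪·, ·⟫`. [folklore] -/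
theorem realFrame_orthonormal : Orthonormal ℝ (realFrame ι) := by
  rw [orthonormal_iff_ite]
  rintro ⟨i, k⟩ ⟨j, l⟩
  simp only [realFrame]
  rw [real_inner_eq_re_inner_euclideanSpace, EuclideanSpace.inner_single_left,
    PiLp.single_apply]
  by_cases hij : i = j
  · subst hij
    fin_cases k <;> fin_cases l <;> simp
  · simp [hij]

variable [Nonempty ι]

/-- The real frame as an orthonormal basis of `ℂ^ι` over `ℝ` (it has `2|ι| = dim_ℝ ℂ^ι`
elements). [folklore] -/
def realBasis : OrthonormalBasis (ι × Fin 2) ℝ (EuclideanSpace ℂ ι) :=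
  (basisOfOrthonormalOfCardEqFinrank (realFrame_orthonormal ι) (by
    rw [finrank_real_of_complex, finrank_euclideanSpace, Fintype.card_prod, Fintype.card_fin,
      mul_comm])).toOrthonormalBasis (by
      rw [coe_basisOfOrthonormalOfCardEqFinrank]; exact realFrame_orthonormal ι)

/-- The basis vectors are the frame vectors. [folklore] -/
theorem realBasis_apply (x : ι × Fin 2) : realBasis ι x = realFrame ι x := by
  simp [realBasis]

/-- The coordinates in the real basis are the real and imaginary parts of the entries. [folklore] -/
theorem realBasis_repr (v : EuclideanSpace ℂ ι) (i : ι) (k : Fin 2) :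
    (realBasis ι).repr v (i, k) = if k = 0 then (v i).re else (v i).im := by
  rw [OrthonormalBasis.repr_apply_apply, realBasis_apply, realFrame,
    real_inner_eq_re_inner_euclideanSpace, EuclideanSpace.inner_single_left]
  fin_cases k <;> simp

/-- **`toLp : (ι → ℂ) → EuclideanSpace ℂ ι` preserves Lebesgue measure**: the product of the
planar Lebesgue measures of the coordinates is the inner-product-space volume of `ℂ^ι` (both give
mass `1` to the parallelepiped of the real orthonormal basis `{eᵢ, i eᵢ}`, a product of unit
squares). [folklore] -/
theorem volume_preserving_toLp_complex :
    MeasurePreserving (toLp 2 : (ι → ℂ) → EuclideanSpace ℂ ι) := by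
  refine ⟨WithLp.measurable_toLp 2 _, ?_⟩
  set e : (ι → ℂ) ≃L[ℝ] EuclideanSpace ℂ ι := (PiLp.continuousLinearEquiv 2 ℝ (fun _ : ι => ℂ)).symm
    with he
  have hcoe : (toLp 2 : (ι → ℂ) → EuclideanSpace ℂ ι) = e := rfl
  rw [hcoe]
  haveI : (Measure.map e (volume : Measure (ι → ℂ))).IsAddHaarMeasure := e.isAddHaarMeasure_map _
  -- the unit square of `ℂ` has planar measure `1`
  set S : Set ℂ := {w | w.re ∈ Icc (0 : ℝ) 1 ∧ w.im ∈ Icc (0 : ℝ) 1} with hS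
  have hSvol : (volume : Measure ℂ) S = 1 := by
    have hpre : S = Complex.measurableEquivRealProd ⁻¹' (Icc (0 : ℝ) 1 ×ˢ Icc (0 : ℝ) 1) := by
      ext w; simp only [hS, mem_setOf_eq, mem_Icc, Complex.measurableEquivRealProd, mem_preimage,
        mem_prod, Homeomorph.toMeasurableEquiv_coe, ContinuousLinearEquiv.coe_toHomeomorph,
        Complex.equivRealProdCLM_apply]
    rw [hpre, Complex.volume_preserving_equiv_real_prod.measure_preimage
      ((measurableSet_Icc.prod measurableSet_Icc).nullMeasurableSet), Measure.volume_eq_prod,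
      Measure.prod_prod, Real.volume_Icc]
    simp
  -- the parallelepiped of the real basis is the product of unit squares
  have hpre : e ⁻¹' {x : EuclideanSpace ℂ ι | ∀ y, (realBasis ι).toBasis.repr x y ∈ Icc (0 : ℝ) 1} =
      Set.pi univ fun _ : ι => S := by
    have hez : ∀ (z : ι → ℂ) (i : ι), (e z).ofLp i = z i := fun z i => rfl
    ext z
    simp only [mem_preimage, mem_setOf_eq, mem_univ_pi, hS, OrthonormalBasis.coe_toBasis_repr_apply,
      Prod.forall, realBasis_repr, hez]
    constructor
    · intro h i
      exact ⟨by simpa using h i 0, by simpa using h i 1⟩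
    · intro h i k
      fin_cases k
      · simpa using (h i).1
      · simpa using (h i).2
  rw [← (realBasis ι).addHaar_eq_volume, eq_comm, Basis.addHaar_eq_iff, Basis.coe_parallelepiped,
    parallelepiped_basis_eq, Measure.map_apply e.continuous.measurable, hpre, volume_pi_pi]
  · simp [hSvol]
  · rw [← parallelepiped_basis_eq, ← Basis.coe_parallelepiped]
    exact (realBasis ι).toBasis.parallelepiped.isCompact.measurableSet

/-- The same statement for `ofLp`. [folklore] -/
theorem volume_preserving_ofLp_complex :
    MeasurePreserving (ofLp : EuclideanSpace ℂ ι → ι → ℂ) :=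
  (volume_preserving_toLp_complex ι).symm (MeasurableEquiv.toLp 2 (ι → ℂ))

end Literature.MeasureTheory.Lebesgue
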